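import Summits.QuantumFields.YangMills.Theorems.LuscherReductionTwistedTraceScalingRecordWeight
import HarnessLib

/-!
# The kernel of the vacuum gauge-mode map `vacGrad` is the constants; on mean-zero site fields `vacGrad` is injective with a bounded inverse (a Poincaré
# constant on the discrete torus, abstractly by finite dimension)
# (input of (N1) «every inner orbit meets the gauge slice», COARSE-DESIGN §23.6 (C); lane A of S-BASE, crux `TwistedTraceScaling` stmt-QuantumFields-20203, C4 INNER)

* `eq_of_vacGrad_eq_zero`: `vacGrad ξ = 0 ⇒ ξ x = ξ 0` for all sites (walk along the axes of `(ℤ/L)³`);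
* `eq_zero_of_vacGrad_eq_zero_of_sum_eq_zero`: a mean-zero site field with vanishing gauge mode is zero;
* ★ `exists_poincare_vacGrad`: `∃ C > 0, ∀ ξ, Σ_x ξ_x = 0 → ‖ξ‖ ≤ C·‖vacGrad ξ‖` (finite-dimensional bounded inverse; no explicit constant needed — it may depend on `L`).
HONEST FRAMING: elementary linear algebra for a stub of a child of the CONDITIONAL reduction route R2b1; no kernel estimate; C4 OPEN; not a gap, not Clay.
-/

set_option autoImplicit false

noncomputable section

open Real
open scoped BigOperators
open Literature.MathematicalPhysics.QuantumFieldTheory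
open Literature.MathematicalPhysics.QuantumLattice

namespace Summit.QuantumFields.YangMills.Theorems.FemtoTransferGap

open TwoLattice TwoLattice.Stiff

variable (L : ℕ) [NeZero L]

omit [NeZero L] in
/-- Components of `vacGrad`. [folklore] -/
theorem vacGrad_apply (ξ : Site 3 L → Fin 3 → ℝ) (e : Edge 3 L) (a : Fin 3) :
    vacGrad L ξ (e, a) = ξ (e.1.shift e.2) a - ξ e.1 a := rfl

omit [NeZero L] in
/-- If the gauge mode vanishes, the field is invariant under every axis shift. [folklore] -/
theorem shift_eq_of_vacGrad_eq_zero {ξ : Site 3 L → Fin 3 → ℝ} (h : vacGrad L ξ = 0) (x : Site 3 L) (k : Fin 3) : ξ (x.shift k) = ξ x := by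
  funext a
  have := congrArg (fun v : LinkSpace L => v ((x, k), a)) h
  simp only [vacGrad_apply] at this
  have h0 : ξ (x.shift k) a - ξ x a = 0 := by simpa using this
  linarith

omit [NeZero L] in
/-- Iterated shifts: `ξ (x + n·e_k) = ξ x`. [folklore] -/
theorem shift_iterate_eq_of_vacGrad_eq_zero {ξ : Site 3 L → Fin 3 → ℝ} (h : vacGrad L ξ = 0) (x : Site 3 L) (k : Fin 3) (n : ℕ) :
    ξ (x + Pi.single k (n : ZMod L)) = ξ x := by
  induction n with
  | zero => simp
  | succ n ih =>
    have hstep : x + Pi.single k ((n + 1 : ℕ) : ZMod L) = (x + Pi.single k (n : ZMod L)).shift k := by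
      simp only [Site.shift, Nat.cast_succ, add_assoc, ← Pi.single_add]
    rw [hstep, shift_eq_of_vacGrad_eq_zero L h, ih]

/-- ★ **The kernel of `vacGrad` is the constants**: `vacGrad ξ = 0 ⇒ ξ x = ξ 0`. [folklore] -/
theorem eq_of_vacGrad_eq_zero {ξ : Site 3 L → Fin 3 → ℝ} (h : vacGrad L ξ = 0) (x : Site 3 L) : ξ x = ξ 0 := by
  -- `x = 0 + x₀ e₀ + x₁ e₁ + x₂ e₂` with natural representatives
  have hx : x = ((0 : Site 3 L) + Pi.single 0 ((ZMod.val (x 0) : ℕ) : ZMod L)) + Pi.single 1 ((ZMod.val (x 1) : ℕ) : ZMod L) +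
      Pi.single 2 ((ZMod.val (x 2) : ℕ) : ZMod L) := by
    funext i
    simp only [Pi.add_apply, Pi.zero_apply, ZMod.natCast_val, ZMod.cast_id', id_eq]
    fin_cases i <;> simp
  rw [hx, shift_iterate_eq_of_vacGrad_eq_zero L h, shift_iterate_eq_of_vacGrad_eq_zero L h, shift_iterate_eq_of_vacGrad_eq_zero L h]

/-- ★ A mean-zero site field with vanishing gauge mode is zero. [folklore] -/
theorem eq_zero_of_vacGrad_eq_zero_of_sum_eq_zero {ξ : Site 3 L → Fin 3 → ℝ} (h : vacGrad L ξ = 0) (hsum : ∑ x : Site 3 L, ξ x = 0) : ξ = 0 := by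
  have hconst : ∀ x, ξ x = ξ 0 := eq_of_vacGrad_eq_zero L h
  have hN : (Fintype.card (Site 3 L) : ℝ) • ξ 0 = 0 := by
    rw [← hsum, Finset.sum_congr rfl fun x _ => hconst x, Finset.sum_const, Finset.card_univ, ← Nat.cast_smul_eq_nsmul ℝ]
  have hN0 : (Fintype.card (Site 3 L) : ℝ) ≠ 0 := by exact_mod_cast Fintype.card_ne_zero
  have h0 : ξ 0 = 0 := by
    have := smul_eq_zero.mp hN
    exact this.resolve_left hN0
  funext x; rw [hconst x, h0]; rfl

/-- The mean-zero site fields. [folklore] -/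
def meanZero : Submodule ℝ (Site 3 L → Fin 3 → ℝ) where
  carrier := {ξ | ∑ x : Site 3 L, ξ x = 0}
  add_mem' {a b} ha hb := by
    simp only [Set.mem_setOf_eq] at ha hb ⊢
    rw [show (∑ x : Site 3 L, (a + b) x) = ∑ x, a x + ∑ x, b x from by simp [Finset.sum_add_distrib], ha, hb, add_zero]
  zero_mem' := by simp
  smul_mem' c a ha := by
    simp only [Set.mem_setOf_eq] at ha ⊢
    rw [show (∑ x : Site 3 L, (c • a) x) = c • ∑ x, a x from by simp [Finset.smul_sum], ha, smul_zero]

/-- `vacGrad` is injective on mean-zero fields. [folklore] -/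
theorem vacGrad_injective_meanZero : Function.Injective ((vacGrad L).domRestrict (meanZero L)) := by
  intro ξ η h
  apply Subtype.ext
  have hsub : vacGrad L (ξ.1 - η.1) = 0 := by
    rw [map_sub]; exact sub_eq_zero.mpr h
  have hsum : ∑ x : Site 3 L, (ξ.1 - η.1) x = 0 := by
    have h1 : ∑ x : Site 3 L, (ξ.1 - η.1) x = ∑ x, ξ.1 x - ∑ x, η.1 x := by simp [Finset.sum_sub_distrib]
    rw [h1, show ∑ x : Site 3 L, ξ.1 x = 0 from ξ.2, show ∑ x : Site 3 L, η.1 x = 0 from η.2, sub_zero]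
  exact sub_eq_zero.mp (eq_zero_of_vacGrad_eq_zero_of_sum_eq_zero L hsub hsum)

/-- ★ **A Poincaré constant on the discrete torus** (abstract, `L`-dependent): `∃ C > 0, ∀ ξ` mean-zero, `‖ξ‖ ≤ C·‖vacGrad ξ‖`. [folklore] -/
theorem exists_poincare_vacGrad : ∃ C : ℝ, 0 < C ∧ ∀ ξ : Site 3 L → Fin 3 → ℝ, ∑ x : Site 3 L, ξ x = 0 → ‖ξ‖ ≤ C * ‖vacGrad L ξ‖ := by
  set f := (vacGrad L).domRestrict (meanZero L) with hf
  have hker : LinearMap.ker f = ⊥ := LinearMap.ker_eq_bot.mpr (vacGrad_injective_meanZero L)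
  obtain ⟨K, hKpos, hK⟩ := f.exists_antilipschitzWith hker
  refine ⟨K, by exact_mod_cast hKpos, fun ξ hξ => ?_⟩
  have hmem : ξ ∈ meanZero L := hξ
  have h := hK.le_mul_dist (⟨ξ, hmem⟩ : meanZero L) 0
  rw [dist_zero_right, map_zero, dist_zero_right] at h
  have h1 : ‖(⟨ξ, hmem⟩ : meanZero L)‖ = ‖ξ‖ := rfl
  have h2 : f ⟨ξ, hmem⟩ = vacGrad L ξ := rfl
  rw [h1, h2] at h
  exact_mod_cast h

end Summit.QuantumFields.YangMills.Theorems.FemtoTransferGap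

end
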